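import Summits.QuantumFields.YangMills.Theorems.BalabanLadderNTBoundaryLawLargeDepth
import Literature.MathematicalPhysics.QuantumLattice.LatticeGaugeDLRCovarianceSplit
import HarnessLib

/-!
# Crux `NT` (stmt-QuantumFields-19353), stub `stub_refpkgT : RefPkgT`: a clause-1 ceiling at lattice depth `≥ d₀` IS a clause-1 ceiling
# at depth `≥ 1` with constant `C₁ + 12N·d₀⁴` — the depth-1 consequences in the tree apply to the re-cut «v4T_{d₀}»

Helper file (`--supports stmt-QuantumFields-19353`) of the fleet lead prover of crux `NT` (unit `ym-spine-19353-p1`, GEN 13); companion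
of `…NTReferenceTorusMinDepthPackage` (NT BY NAME from the package with ceilings at depth `≥ d₀`) and `…NTCornerPrice` (at `1 ≤ depth`
the unit cube forces `C₁ ≥ 6(N − Re tr ρ(g))`).  Hypothesis-free, general compact `G`, any `r`, one coupling.

Sites of depth `1 ≤ d < d₀` obey the TRIVIAL oscillation bound `|kerE^η(dens_x) − kerE^{η'}(dens_x)| ≤ 12N` (kernel means of an
observable bounded by `6N`, tree `abs_curvature_le` + `BoundaryLaw.abs_kerE_le`), and `12N ≤ 12N·d₀⁴/d⁴` there; so

* `abs_kerE_dens_sub_le` — `|kerE^η(dens_x) − kerE^{η'}(dens_x)| ≤ 12N` always;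
* **`e1osc_depthOne_of_minDepth`** — E1-osc at depth `≥ d₀` with constant `C₁ ≥ 0` ⇒ E1-osc at depth `≥ 1` with constant
  `C₁ + 12N·d₀⁴` (same coupling, spacing, range); `e1osc_depthOne_of_minDepth_eventually` — the `∃ β₁ ∀ β ≥ β₁` form.

READING (memo SIZING-19353-g13 §3(a)).  Every depth-1 consequence already in the tree — GEN 12's cap-based prices
(`CeilingPrice.floor₂_le_of_e1osc`, `timeGap_le_collar`, `C₂_le_of_clause4`, …, which USE clause 1 only at cube centres of depth `≥ 3`) and
this seat's AF collar law — applies verbatim to an instance of the depth-`d₀` re-cut with `C₁ ↦ C₁ + 12N·d₀⁴` on the CAP side; the corner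
price itself becomes vacuous (`C₁ + 12N·d₀⁴ ≥ 12N ≥ D` automatically), which is the point of the re-cut.  (The sharp versions with the
same `C₁` on the cap side hold by the same proofs, which never visit depth `< 3`; not re-derived here.)

HONEST FRAMING.  Elementary; nothing about the truth of any clause; not a floor, not AF, not NT, not the seam, not the gap; not Clay.
-/

set_option autoImplicit false

noncomputable section

open MeasureTheory Filter Topology
open Literature.MathematicalPhysics.QuantumFieldTheory Literature.MathematicalPhysics.QuantumLattice
open Literature.Probability.LatticeModels
open Summit.QuantumFields.YangMills.Cruxes.OSLegsFromFemtoAndGap.DlrCollarTransfer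

namespace Summit.QuantumFields.YangMills.Cruxes.NT.CornerPrice

section Reduction

variable (G : Type) [Group G] [TopologicalSpace G] [IsTopologicalGroup G] [CompactSpace G]
  [MeasurableSpace G] [BorelSpace G] (r : LatticeRep G)

/-- The action density at any site is bounded by `6N`. [folklore] -/
theorem abs_dens_le (x : Fin 4 → ℤ) (U : LGConfig 4 G) : |dens G r x U| ≤ 6 * r.N :=
  abs_curvature_le r _

/-- **Trivial oscillation bound**: `|kerE^η(dens_x) − kerE^{η'}(dens_x)| ≤ 12N` for every cube, every pair of exteriors and every
site. [folklore] -/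
theorem abs_kerE_dens_sub_le (β : ℝ) (c : Fin 4 → ℤ) (b : ℕ) (η η' : LGConfig 4 G) (x : Fin 4 → ℤ) :
    |kerE G r β c b η (dens G r x) - kerE G r β c b η' (dens G r x)| ≤ 12 * r.N := by
  have h1 := BoundaryLaw.abs_kerE_le G r β c b η (abs_dens_le G r x)
  have h2 := BoundaryLaw.abs_kerE_le G r β c b η' (abs_dens_le G r x)
  calc |kerE G r β c b η (dens G r x) - kerE G r β c b η' (dens G r x)|
      ≤ |kerE G r β c b η (dens G r x)| + |kerE G r β c b η' (dens G r x)| := abs_sub _ _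
    _ ≤ 6 * r.N + 6 * r.N := add_le_add h1 h2
    _ = 12 * r.N := by ring

/-- **A clause-1 ceiling at depth `≥ d₀` is a clause-1 ceiling at depth `≥ 1` with constant `C₁ + 12N·d₀⁴`** (one coupling `β`,
spacing `s`, range `ℓ`). [folklore] -/
theorem e1osc_depthOne_of_minDepth (β : ℝ) {C₁ ℓ s : ℝ} (hC₁ : 0 ≤ C₁) (d₀ : ℕ)
    (hE1 : ∀ (c : Fin 4 → ℤ) (b : ℕ), (b : ℝ) * s ≤ ℓ → ∀ (η η' : LGConfig 4 G) (x : Fin 4 → ℤ),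
      d₀ ≤ depth c b x → |kerE G r β c b η (dens G r x) - kerE G r β c b η' (dens G r x)| ≤ C₁ / (depth c b x : ℝ) ^ 4)
    (c : Fin 4 → ℤ) (b : ℕ) (hb : (b : ℝ) * s ≤ ℓ) (η η' : LGConfig 4 G) (x : Fin 4 → ℤ) (hx : 1 ≤ depth c b x) :
    |kerE G r β c b η (dens G r x) - kerE G r β c b η' (dens G r x)| ≤ (C₁ + 12 * r.N * (d₀ : ℝ) ^ 4) / (depth c b x : ℝ) ^ 4 := by
  have hd : (1 : ℝ) ≤ depth c b x := by exact_mod_cast hx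
  have hd4 : 0 < (depth c b x : ℝ) ^ 4 := by positivity
  have hN : (0 : ℝ) ≤ 12 * r.N * (d₀ : ℝ) ^ 4 := by positivity
  rcases le_or_gt d₀ (depth c b x) with hle | hlt
  · refine (hE1 c b hb η η' x hle).trans ?_
    exact div_le_div_of_nonneg_right (by linarith) hd4.le
  · have hdd : (depth c b x : ℝ) ≤ d₀ := by exact_mod_cast hlt.le
    rw [le_div_iff₀ hd4]
    have h12 := abs_kerE_dens_sub_le G r β c b η η' x
    have hpow : (depth c b x : ℝ) ^ 4 ≤ (d₀ : ℝ) ^ 4 := pow_le_pow_left₀ (by positivity) hdd 4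
    have h0 : 0 ≤ |kerE G r β c b η (dens G r x) - kerE G r β c b η' (dens G r x)| := abs_nonneg _
    have hN0 : (0 : ℝ) ≤ 12 * r.N := by positivity
    nlinarith [mul_le_mul h12 hpow hd4.le hN0]

/-- **The registered form**: the `∃ β₁ ∀ β ≥ β₁` clause-1 ceiling at depth `≥ d₀` (constant `C₁ ≥ 0`) gives the `1 ≤ depth`
clause of skeleton v4T with constant `C₁ + 12N·d₀⁴`. [folklore] -/
theorem e1osc_depthOne_of_minDepth_eventually (a : ℝ → ℝ) {C₁ ℓ : ℝ} (hC₁ : 0 ≤ C₁) (d₀ : ℕ)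
    (hE1 : ∃ β₁ : ℝ, ∀ β : ℝ, β₁ ≤ β → ∀ (c : Fin 4 → ℤ) (b : ℕ), (b : ℝ) * a β ≤ ℓ →
      ∀ (η η' : LGConfig 4 G) (x : Fin 4 → ℤ), d₀ ≤ depth c b x →
        |kerE G r β c b η (dens G r x) - kerE G r β c b η' (dens G r x)| ≤ C₁ / (depth c b x : ℝ) ^ 4) :
    ∃ β₁ : ℝ, ∀ β : ℝ, β₁ ≤ β → ∀ (c : Fin 4 → ℤ) (b : ℕ), (b : ℝ) * a β ≤ ℓ →
      ∀ (η η' : LGConfig 4 G) (x : Fin 4 → ℤ), 1 ≤ depth c b x →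
        |kerE G r β c b η (dens G r x) - kerE G r β c b η' (dens G r x)| ≤
          (C₁ + 12 * r.N * (d₀ : ℝ) ^ 4) / (depth c b x : ℝ) ^ 4 := by
  obtain ⟨β₁, H1⟩ := hE1
  exact ⟨β₁, fun β hβ c b hb η η' x hx => e1osc_depthOne_of_minDepth G r β hC₁ d₀ (H1 β hβ) c b hb η η' x hx⟩

omit [IsTopologicalGroup G] [CompactSpace G] [MeasurableSpace G] [BorelSpace G] in
/-- The new constant is non-negative and dominates both `C₁` and `12N` (for `d₀ ≥ 1`) — in particular the corner price
`C₁' ≥ 6(N − Re tr ρ(g))` is automatic for it. [folklore] -/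
theorem le_minDepthConst {C₁ : ℝ} (hC₁ : 0 ≤ C₁) {d₀ : ℕ} (hd₀ : 1 ≤ d₀) :
    0 ≤ C₁ + 12 * r.N * (d₀ : ℝ) ^ 4 ∧ C₁ ≤ C₁ + 12 * r.N * (d₀ : ℝ) ^ 4 ∧ 12 * (r.N : ℝ) ≤ C₁ + 12 * r.N * (d₀ : ℝ) ^ 4 := by
  have hd : (1 : ℝ) ≤ (d₀ : ℝ) ^ 4 := one_le_pow₀ (by exact_mod_cast hd₀)
  have hN : (0 : ℝ) ≤ 12 * r.N := by positivity
  refine ⟨by positivity, by nlinarith, by nlinarith⟩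

end Reduction

end Summit.QuantumFields.YangMills.Cruxes.NT.CornerPrice

end
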